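import Literature.Probability.LatticeModels.TriangularLattice
import Literature.Probability.LatticeModels.IsoradialPercolation
import Literature.Probability.Percolation.Percolation
import Literature.Probability.Percolation.StarTriangleIsoradial
import HarnessLib

/-!
# The box-crossing (RSW) property of critical bond percolation on the triangular lattice (Grimmett–Manolescu 2013)

Topic `Literature/Probability/Percolation`. Named fact (statement only, D-0014) vendoring the
homogeneous triangular case of the main theorem of

* G. R. Grimmett, I. Manolescu, *Inhomogeneous bond percolation on square, triangular and
  hexagonal lattices*, Ann. Probab. **41** (2013) 2990–3025 = arXiv:1105.5535 [GrimmettManolescuAOP2013],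

for the route item `Summit.CriticalPhenomena.CardyFormulaZ2.Theses.CardyBondTriangular.BondTriangularBoxCrossing`
(stmt-CriticalPhenomena-7023), which it grounds (`GrimmettManolescuAOP2013_triangular_boxCrossing.route_normalisation`).

## Source (printed statements, arXiv:1105.5535, §1.3 "Main results")

* Definition (box-crossing property): "Let `G = (V, E)` be a countable connected graph embedded
  in the plane. We say that a measure `P` on `Ω = {0,1}^E` has the *box-crossing property* if, for
  `α > 0`, there exists `δ > 0` such that: for all large `N ∈ ℕ` and any box `S` of size `αN × N`,
  `S` possesses open crossings with probability at least `δ`." Here "a box `S` of size `h × l` is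
  a subset of `ℝ²` of the form `f(S_{h,l})`, `S_{h,l} = [0,h] × [0,l]`, for some map `f : ℝ² → ℝ²`
  comprising a rotation and a translation", and `S` "possess[es] open crossings if there exist two
  open paths of `G` (viewed as arcs in the plane) whose intersection with `S` are arcs having one
  endpoint in each of the sets `f({0} × [0,l])` and `f({h} × [0,l])` (respectively, each of the
  sets `f([0,h] × {0})` and `f([0,h] × {l})`)." "Note that the box-crossing property depends on
  the embedding. … the triangular lattice has vertex-set `{a i + b j : a, b ∈ ℤ}` [edge length `2`,
  one edge direction horizontal] … Note that the box-crossing property is invariant under affine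
  maps of `ℝ²`."
* Main Theorem (first theorem of §1.3; part (b)): "If `p ∈ [0,1)³` satisfies `κ_△(p) = 0`, then
  both `P^△_p` and `P^hex_{1−p}` have the box-crossing property", where (§1.2, eq. (2))
  `κ_△(p) = p₀ + p₁ + p₂ − p₀p₁p₂ − 1` and `P^△_p` is bond percolation on `𝕋` whose edge parameter
  is `p_k` on the edges parallel to the `k`-th direction.

## What is vendored and how it is rendered

Only the HOMOGENEOUS case `p = (p, p, p)`, `3p − p³ = 1`, i.e. `p = 2 sin(π/18) = p_c^bond(𝕋)`:
in the tree this is `bondPercolation triGraph (criticalWeightI (π/6))` (independent edges of the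
tree's triangular lattice `triGraph` on `Site 2`, all of weight `criticalWeightI (π/6)`;
`criticalWeight_pi_div_six : criticalWeight (π/6) = 2 sin(π/18)` and
`StarTriangle.kappa_triangular : kappa (fun _ => 2 sin(π/18)) = 0` record that this is the
self-dual point of the source). The inhomogeneous measures `P^△_p`, `P^hex_{1−p}` of the source
are not in the tree and are NOT vendored here.

Rendering of "box-crossing property": the tree's two-sided, axis-parallel predicate
`LatticeModels.HasBoxCrossingProperty μ z` (for every aspect ratio `ρ > 0` there are `c > 0`, `n₀`
with all translates of `[0, ρn] × [0, n]` crossed horizontally and of `[0, n] × [0, ρn]`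
vertically with probability in `[c, 1 − c]` for all `n ≥ n₀`), exactly as the tree renders the
same words of Grimmett–Manolescu 2014, Thm 1.1(a) (`gm_boxCrossing`, `square_boxCrossing` in
`Isoradial.lean`; the upper bounds `1 − c` are the printed lower bounds for the DUAL model —
here `P^hex_{1−p}`, covered by the same part (b) — through planar duality). The printed
definition allows every rotation of the box and the source notes invariance under affine maps;
we keep only what the consumer needs and what is literally weaker than print: axis-parallel
boxes for every drawing `x ↦ s · triEmbed x` obtained from the tree's unit-edge equilateral
embedding `triEmbed` (one edge direction horizontal, as in the source's embedding of edge
length `2`) by a real scaling `0 < s ≤ 2`, i.e. of EDGE LENGTH `s ≤ 2` (translations are already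
quantified inside `BoxCrossingBounds`; `HasBoxCrossingProperty.sub_const`). The source's property
is scale-free ("for all large `N`", any real aspect ratio, any box); the restriction `s ≤ 2` is
forced by the TREE's rendering, whose crossing events `embRectCrossing`/`embTBCrossing` carry a
fixed slack `2` (start vertices within distance `2` of a side) and are therefore meaningful only
for drawings of edge length `≤ 2` (module docstring of `IsoradialPercolation`): for edge length
`s > 4` some translate of every box has no vertex in its slack strips and `BoxCrossingBounds`
fails trivially (review of the first version of this file, p57076, which quantified all `s > 0`
and was rightly bounced as false in the tree's predicate). With `s ≤ 2` consecutive vertex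
columns are `s/2 ≤ 1` apart and rows `s√3/2 ≤ √3` apart, inside the slack.

Not here: the inhomogeneous/`highly inhomogeneous' versions (their Theorems 1.x of §1.3–1.4),
criticality (their Theorem 1.1, in the tree for isoradial graphs as `gm_theta_critical_eq_zero`),
and any proof (≈ the star–triangle transport of §§2–3 of the source).
-/

noncomputable section

namespace Literature.Probability.Percolation

open Literature.Probability.LatticeModels

/-- **Grimmett–Manolescu 2013, main Theorem (b), homogeneous triangular case** (Ann. Probab. 41
(2013), §1.3, first theorem, part (b): "If `p ∈ [0,1)³` satisfies `κ_△(p) = 0`, then both `P^△_p`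
and `P^hex_{1−p}` have the box-crossing property"; at `p = (p,p,p)` with `3p − p³ = 1`, i.e.
`p = 2 sin(π/18) = criticalWeight (π/6)`): critical bond percolation on the triangular lattice,
`bondPercolation triGraph (criticalWeightI (π/6))`, has the box-crossing property
(`HasBoxCrossingProperty`, two-sided axis-parallel rendering, see the module docstring) in every
drawing `x ↦ s · triEmbed x` of edge length `0 < s ≤ 2` of the equilateral embedding (the
bound `2` = the slack of the tree's crossing events, see the module docstring; all translates are
quantified inside the predicate). Statement only. It grounds
`Summit.CriticalPhenomena.CardyFormulaZ2.Theses.CardyBondTriangular.BondTriangularBoxCrossing`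
(stmt-CriticalPhenomena-7023: the drawing `√3 · (triEmbed x − (1 + ζ)/3)`, edge length `√3`, see
`GrimmettManolescuAOP2013_triangular_boxCrossing.route_normalisation`).
[cite: GrimmettManolescuAOP2013, §1.3 main Theorem (b) (arXiv:1105.5535 flat numbering: Theorem 3 (b)) with the Definition of the box-crossing property preceding it] -/
def GrimmettManolescuAOP2013_triangular_boxCrossing : Prop :=
  ∀ s : ℝ, 0 < s → s ≤ 2 →
    HasBoxCrossingProperty (bondPercolation triGraph (criticalWeightI (Real.pi / 6)))
      (fun x : Site 2 => (s : ℂ) * triEmbed x)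

/-- Bookkeeping: the fact delivers the box-crossing property in the normalisation used by route
`CardyBondTriangular` of `CriticalPhenomena/CardyFormulaZ2` (unit circumradius, up-triangle
centroids on `√3 · 𝕋`: `z x = √3 · (triEmbed x − (1 + ζ)/3) = √3 · triEmbed x − √3 (1 + ζ)/3`, edge
length `√3 ≤ 2`; translation by `HasBoxCrossingProperty.sub_const`),
i.e. literally the body of `…CardyBondTriangular.BondTriangularBoxCrossing`. [folklore] -/
theorem GrimmettManolescuAOP2013_triangular_boxCrossing.route_normalisation
    (h : GrimmettManolescuAOP2013_triangular_boxCrossing) :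
    HasBoxCrossingProperty (bondPercolation triGraph (criticalWeightI (Real.pi / 6)))
      (fun x : Site 2 => (Real.sqrt 3 : ℂ) * (triEmbed x - (1 + triZeta) / 3)) := by
  have h3 : (0 : ℝ) < Real.sqrt 3 := Real.sqrt_pos.mpr (by norm_num)
  have h32 : Real.sqrt 3 ≤ 2 := by
    rw [show (2 : ℝ) = Real.sqrt (2 ^ 2) by rw [Real.sqrt_sq (by norm_num)]]
    exact Real.sqrt_le_sqrt (by norm_num)
  have := (h (Real.sqrt 3) h3 h32).sub_const ((Real.sqrt 3 : ℂ) * ((1 + triZeta) / 3))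
  convert this using 2 with x
  ring

end Literature.Probability.Percolation

end
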